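import Summits.Parity.BatemanHorn.Theses.RoughValueTransport

/-!
# `BalancedSemiprimeLayer` (crux stmt-Parity-9469): Bateman–Horn systems contain no constants

Negative-side support lemma (cdisprove): every member of an `IsBatemanHornSystem` has degree `≥ 1`
— a positive constant `c ≠ 1` has a prime factor, which is a fixed prime divisor. Used by the
disproof work file to show that `hasNoFixedPrimeDivisor` is load-bearing for the crux ONLY through
prime constants.
-/

namespace Summit.Parity.BatemanHorn.Theorems.BalancedSemiprimeLayer.Negative

open Finset Polynomial
open Literature.NumberTheory.Sieve

/-- Every member of a Bateman–Horn system has degree `≥ 1`: a constant `c > 0`, `c ≠ 1`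
(irreducible ⇒ not a unit) has a prime factor, which is a fixed prime divisor. [folklore] -/
theorem natDegree_pos_of_isBatemanHornSystem {k : ℕ} {f : Fin k → ℤ[X]}
    (hf : IsBatemanHornSystem f) (i : Fin k) : 0 < (f i).natDegree := by
  by_contra h0
  push Not at h0
  have hdeg : (f i).natDegree = 0 := Nat.le_zero.mp h0
  have hC : f i = C ((f i).coeff 0) := eq_C_of_natDegree_eq_zero hdeg
  have hc_pos : 0 < (f i).coeff 0 := by
    have := hf.leadingCoeff_pos i
    rwa [leadingCoeff, hdeg] at this
  have hc_ne_one : (f i).coeff 0 ≠ 1 := by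
    intro h1
    have hu := (hf.irreducible i).not_isUnit
    rw [hC, h1, C_1] at hu
    exact hu isUnit_one
  have h2 : 2 ≤ ((f i).coeff 0).toNat := by omega
  set q : ℕ := ((f i).coeff 0).toNat.minFac with hq_def
  have hq : q.Prime := Nat.minFac_prime (by omega)
  have hqc : (q : ℤ) ∣ (f i).coeff 0 := by
    have : ((q : ℕ) : ℤ) ∣ ((((f i).coeff 0).toNat : ℕ) : ℤ) :=
      Int.natCast_dvd_natCast.mpr (Nat.minFac_dvd _)
    rwa [Int.toNat_of_nonneg hc_pos.le] at this
  have hfix : polyRootCountMod f q = q := by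
    unfold polyRootCountMod
    rw [Finset.filter_true_of_mem, card_range]
    intro n _
    have hev : (f i).eval (n : ℤ) = (f i).coeff 0 := by
      conv_lhs => rw [hC]
      rw [eval_C]
    exact (hqc.trans (dvd_of_eq hev.symm)).trans (Finset.dvd_prod_of_mem _ (mem_univ i))
  have := hf.hasNoFixedPrimeDivisor q hq
  omega

end Summit.Parity.BatemanHorn.Theorems.BalancedSemiprimeLayer.Negative
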